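import Literature.AlgebraicGeometry.Resolution.DiffIdealSupportOrder
import Literature.AlgebraicGeometry.Resolution.IsolatedOrderPoint
import Mathlib.RingTheory.Nakayama
import Mathlib.RingTheory.Finiteness.Ideal
import Literature.AlgebraicGeometry.Resolution.NodeFittingIdeal
import HarnessLib

/-!
# An isolated point of `{ord ≥ n+1}` admits no APPROXIMATE `(n+1)`-fold positive-dimensional germ

Topic: `Literature/AlgebraicGeometry/Resolution`. Companion of `IsolatedOrderPoint.lean` (exact form: at an isolated
point `x` of `Σ = {ord 𝓘 ≥ n+1}` no non-maximal prime `𝔮 ⊂ 𝒪_{X,x}` has `𝓘_x 𝒪_𝔮 ⊆ 𝔮^{n+1}𝒪_𝔮`) in the APPROXIMATE form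
that termination arguments by «infinitely near stall phases» consume: for `f : X → Spec K` smooth, `K` perfect, `X`
integral Noetherian, and a point `x` such that no proper generization `ζ ⤳ x` has `ord_ζ 𝓘 ≥ n + 1`,

* `exists_pow_maximalIdeal_le_diffIdeal_of_isolated` — the differential ideal `Diff^{≤ n}(𝓘_x) ⊆ 𝒪_{X,x}` (Grothendieck
  operators of the `K`-algebra `𝒪_{X,x}`, the tree's `diffIdeal`) contains a power `𝔪_x^N` of the maximal ideal: its only
  prime is `𝔪_x`, because a prime `𝔮 ⊇ Diff^{≤ n}(𝓘_x)` is the contraction of `𝔪_ζ` for a generization `ζ`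
  (`exists_specializes_comap_stalkSpecializes_eq`, Stacks 01J7), `(Diff^{≤ n} 𝓘)_ζ = (Diff^{≤ n} 𝓘)_x 𝒪_ζ ⊆ 𝔪_ζ` puts `ζ` in
  `Supp(𝒪/Diff^{≤ n}𝓘) = {ord ≥ n+1}` (`support_diffIdealSheaf_eq_setOf_le_idealOrder`, [VillamayorU2008ReesDiff] §4.1), so
  `ζ = x`;
* `exists_pow_le_of_le_sup_pow_of_isolated` — **the approximate exit**: there is `N = N(𝓘, x)` such that for EVERY ideal
  `𝔞 ⊆ 𝒪_{X,x}`, `𝓘_x ⊆ 𝔞^{n+1} + 𝔪_x^{N+n+1}` forces `𝔪_x^N ⊆ 𝔞` (so `𝔞` is `𝔪_x`-primary): operators of order `≤ n` send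
  `𝔞^{n+1}` into `𝔞` and `𝔪^{N+n+1}` into `𝔪^{N+1}` (`IsDiffOpLE.apply_mem_pow_sub`), whence
  `𝔪^N ⊆ Diff^{≤ n}(𝓘_x) ⊆ 𝔞 + 𝔪·𝔪^N`, and Nakayama (`Submodule.le_of_le_smul_of_le_jacobson_bot`) gives `𝔪^N ⊆ 𝔞`;
* `not_le_sup_pow_of_isolated_of_isPrime` — in particular `𝓘_x ⊄ 𝔮^{n+1} + 𝔪_x^{N+n+1}` for every non-maximal prime
  `𝔮` (e.g. the ideal of a regular curve germ through `x`): an isolated `(n+1)`-fold point is not even `(n+1)`-fold ALONG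
  A CURVE TO HIGH ORDER. The bound `N` depends on `(𝓘, x)` only, not on `𝔮`.

Why (index only): termination proofs for point blow-ups of hypersurfaces of order `p` in characteristic `p` conclude
from an infinite stall phase that the equation is a formal `p`-th power along a smooth formal curve, contradicting the
isolatedness of the `p`-fold locus through a COMPLETION exit door; with this file a FINITE stall phase of length
`> N` already contradicts isolatedness, with no completion and no limit. The campaign `res-hironaka` (slot W4.6, rung
(iii)) consumes it; nothing of Hironaka's 2017 manuscript is used or asserted here.
Sources: [VillamayorU2008ReesDiff] §4.1 (order loci by `Diff^{b−1}`); [CossartPiltant2008] proof of Prop. 4.4 p. 11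
(isolated points of `Σ`); [StacksProject] Tags 01J7, 00DV (Nakayama).
-/

noncomputable section

namespace Literature.AlgebraicGeometry.Resolution

open CategoryTheory _root_.AlgebraicGeometry TopologicalSpace IsLocalRing Opposite

universe u v

/-! ## §1 Ring level: differential ideals of `𝔞^{n+1} + P^M`, and the Nakayama step -/

section Ring

variable (R : Type*) {A : Type*} [CommSemiring R] [CommRing A] [Algebra R A]

/-- **`J ⊆ 𝔞^{n+1} + P^M ⇒ Diff^{≤ n}(J) ⊆ 𝔞 + P^{M−n}`**: an operator of order `≤ n` lowers `𝔞`-adic and `P`-adic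
orders by at most `n` (`IsDiffOpLE.apply_mem_pow_sub`). [cite: VillamayorU2008ReesDiff, Def. 3.3 (4) and §4.1] -/
theorem diffIdeal_le_sup_pow_of_le_sup_pow {J 𝔞 P : Ideal A} {n M : ℕ} (h : J ≤ 𝔞 ^ (n + 1) ⊔ P ^ M) :
    diffIdeal R n J ≤ 𝔞 ⊔ P ^ (M - n) := by
  refine (diffIdeal_le_iff R).mpr fun D hD f hf => ?_
  obtain ⟨a, ha, m, hm, rfl⟩ := Submodule.mem_sup.mp (h hf)
  rw [map_add]
  refine Ideal.add_mem _ (Ideal.mem_sup_left ?_) (Ideal.mem_sup_right (hD.apply_mem_pow_sub P M hm))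
  have h1 := hD.apply_mem_pow_sub 𝔞 (n + 1) ha
  rwa [Nat.add_sub_cancel_left, pow_one] at h1

variable {R}

/-- **Nakayama step**: in a commutative ring, if `P` lies in the Jacobson radical, `P^N` is finitely generated and
`P^N ⊆ D ⊆ 𝔞 + P^{N+1}`, then `P^N ⊆ 𝔞` (`P^{N+1} = P • P^N` and `Submodule.le_of_le_smul_of_le_jacobson_bot`).
[cite: StacksProject, Tag 00DV (4)] -/
theorem pow_le_of_pow_le_of_le_sup_pow_succ {P 𝔞 D : Ideal A} (hP : P ≤ Ideal.jacobson ⊥) {N : ℕ}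
    (hfg : (P ^ N).FG) (h₁ : P ^ N ≤ D) (h₂ : D ≤ 𝔞 ⊔ P ^ (N + 1)) : P ^ N ≤ 𝔞 := by
  refine Submodule.le_of_le_smul_of_le_jacobson_bot hfg hP (h₁.trans (h₂.trans ?_))
  rw [pow_succ', Ideal.smul_eq_mul]

end Ring

/-! ## §2 Scheme level: smooth over a perfect field -/

section Scheme

variable {K : Type u} [Field K] {X : Scheme.{u}} (f : X ⟶ Spec (.of K))

/-- **`Diff^{≤ n}(𝓘_x)` is `𝔪_x`-primary at an isolated point of `{ord 𝓘 ≥ n+1}`** (`X` integral Noetherian, `f : X → Spec K`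
smooth, `K` perfect; the `K`-structure of `𝒪_{X,x}` is `K → Γ(X, 𝒪_X) → 𝒪_{X,x}`, `Resolution.stalkAlgebra`): if no
generization `ζ ≠ x` of `x` has `ord_ζ 𝓘 ≥ n + 1`, some power `𝔪_x^N` lies in `Diff^{≤ n}(𝓘_x)`. A prime `𝔮 ⊇ Diff^{≤ n}(𝓘_x)`
is `(stalkSpecializes)⁻¹ 𝔪_ζ` for a generization `ζ` (Stacks 01J7); then `(Diff^{≤ n}𝓘)_ζ = (Diff^{≤ n}(𝓘_x))𝒪_ζ ⊆ 𝔪_ζ`, i.e.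
`ζ ∈ Supp(𝒪/Diff^{≤ n}𝓘) = {ord 𝓘 ≥ n+1}`, so `ζ = x` and `𝔮 = 𝔪_x`; the radical of `Diff^{≤ n}(𝓘_x)` is therefore `⊇ 𝔪_x`,
and `𝔪_x` is finitely generated. [cite: VillamayorU2008ReesDiff, §4.1 and Remark 4.3]
[cite: CossartPiltant2008, proof of Prop. 4.4, p. 11] [cite: StacksProject, Tag 01J7] -/
theorem exists_pow_maximalIdeal_le_diffIdeal_of_isolated [IsIntegral X] [IsNoetherian X] [Smooth f] [PerfectField K]
    (I : X.IdealSheafData) {x : X} {n : ℕ}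
    (hisol : ∀ ζ : X, ζ ⤳ x → ζ ≠ x → ¬ (((n + 1 : ℕ) : ℕ∞) ≤ idealOrder I ζ)) :
    ∃ N : ℕ, (letI := stalkAlgebra (f.appTop.hom.comp (Scheme.ΓSpecIso (.of K)).inv.hom) x
      maximalIdeal (X.presheaf.stalk x) ^ N ≤ diffIdeal K n (stalkIdeal I x)) := by
  letI := stalkAlgebra (f.appTop.hom.comp (Scheme.ΓSpecIso (.of K)).inv.hom) x
  have hft := hasFiniteTypeSections_of_locallyOfFiniteType K f
  -- every prime over `Diff^{≤ n}(𝓘_x)` is the maximal ideal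
  have hrad : maximalIdeal (X.presheaf.stalk x) ≤ (diffIdeal K n (stalkIdeal I x)).radical := by
    rw [Ideal.radical_eq_sInf]
    refine le_sInf ?_
    rintro 𝔮 ⟨hD𝔮, h𝔮⟩
    by_contra hne
    have h𝔮ne : 𝔮 ≠ maximalIdeal (X.presheaf.stalk x) := fun h => hne h.ge
    obtain ⟨ζ, hζx, hP⟩ := exists_specializes_comap_stalkSpecializes_eq x 𝔮
    have hζne : ζ ≠ x := by
      rintro rfl
      exact h𝔮ne (hP.trans (comap_stalkSpecializes_refl_maximalIdeal ζ))
    refine hisol ζ hζx hζne ?_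
    have hmem : ζ ∈ ((diffIdealSheaf (f.appTop.hom.comp (Scheme.ΓSpecIso (.of K)).inv.hom) n I).support :
        Set X) := by
      rw [SetLike.mem_coe, mem_support_iff_stalkIdeal_le, ← stalkIdeal_map_stalkSpecializes _ hζx,
        stalkIdeal_diffIdealSheaf hft n I x, Ideal.map_le_iff_le_comap, ← hP]
      exact hD𝔮
    rw [support_diffIdealSheaf_eq_setOf_le_idealOrder f I n] at hmem
    exact hmem
  exact Ideal.exists_pow_le_of_le_radical_of_fg hrad (IsNoetherian.noetherian _)

/-- **The approximate exit at an isolated point of `{ord 𝓘 ≥ n+1}`**: under the same hypotheses there is `N` (depending on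
`𝓘` and `x` only) such that for EVERY ideal `𝔞 ⊆ 𝒪_{X,x}`, `𝓘_x ⊆ 𝔞^{n+1} + 𝔪_x^{N+n+1}` implies `𝔪_x^N ⊆ 𝔞` — so `𝔞` is
`𝔪_x`-primary. (`𝔪^N ⊆ Diff^{≤ n}(𝓘_x) ⊆ 𝔞 + 𝔪^{N+1} = 𝔞 + 𝔪·𝔪^N`, Nakayama.) Contrapositive: `𝓘_x` is not approximately
`(n+1)`-fold along ANY non-`𝔪_x`-primary ideal (curve germ, surface germ, …) beyond the uniform order `N + n + 1`.
[cite: VillamayorU2008ReesDiff, §4.1 and Remark 4.3] [cite: CossartPiltant2008, proof of Prop. 4.4, p. 11]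
[cite: StacksProject, Tag 00DV (4)] -/
theorem exists_pow_le_of_le_sup_pow_of_isolated [IsIntegral X] [IsNoetherian X] [Smooth f] [PerfectField K]
    (I : X.IdealSheafData) {x : X} {n : ℕ}
    (hisol : ∀ ζ : X, ζ ⤳ x → ζ ≠ x → ¬ (((n + 1 : ℕ) : ℕ∞) ≤ idealOrder I ζ)) :
    ∃ N : ℕ, ∀ 𝔞 : Ideal (X.presheaf.stalk x),
      stalkIdeal I x ≤ 𝔞 ^ (n + 1) ⊔ maximalIdeal (X.presheaf.stalk x) ^ (N + n + 1) →
        maximalIdeal (X.presheaf.stalk x) ^ N ≤ 𝔞 := by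
  letI := stalkAlgebra (f.appTop.hom.comp (Scheme.ΓSpecIso (.of K)).inv.hom) x
  obtain ⟨N, hN⟩ := exists_pow_maximalIdeal_le_diffIdeal_of_isolated f I hisol
  refine ⟨N, fun 𝔞 h => ?_⟩
  have h₂ := diffIdeal_le_sup_pow_of_le_sup_pow K h
  rw [show N + n + 1 - n = N + 1 by omega] at h₂
  exact pow_le_of_pow_le_of_le_sup_pow_succ (maximalIdeal_le_jacobson ⊥) (IsNoetherian.noetherian _) hN h₂

/-- **No approximate `(n+1)`-fold structure along a non-maximal prime**: with `N` as in
`exists_pow_le_of_le_sup_pow_of_isolated`, for every prime `𝔮 ≠ 𝔪_x` of `𝒪_{X,x}` (the germ of a positive-dimensional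
integral subvariety through `x`, e.g. a regular curve germ) `𝓘_x ⊄ 𝔮^{n+1} + 𝔪_x^{N+n+1}`. The exact form (`N = ∞`) is
`IsolatedOrderPoint.not_map_le_pow_of_isolated`. [cite: CossartPiltant2008, proof of Prop. 4.4, p. 11]
[cite: VillamayorU2008ReesDiff, §4.1] -/
theorem exists_forall_not_le_sup_pow_of_isolated [IsIntegral X] [IsNoetherian X] [Smooth f] [PerfectField K]
    (I : X.IdealSheafData) {x : X} {n : ℕ}
    (hisol : ∀ ζ : X, ζ ⤳ x → ζ ≠ x → ¬ (((n + 1 : ℕ) : ℕ∞) ≤ idealOrder I ζ)) :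
    ∃ N : ℕ, ∀ 𝔮 : Ideal (X.presheaf.stalk x), 𝔮.IsPrime → 𝔮 ≠ maximalIdeal (X.presheaf.stalk x) →
      ¬ stalkIdeal I x ≤ 𝔮 ^ (n + 1) ⊔ maximalIdeal (X.presheaf.stalk x) ^ (N + n + 1) := by
  obtain ⟨N, hN⟩ := exists_pow_le_of_le_sup_pow_of_isolated f I hisol
  refine ⟨N, fun 𝔮 h𝔮 hne hle => hne ?_⟩
  -- `𝔪^N ⊆ 𝔮` with `𝔮` prime gives `𝔪 ⊆ 𝔮`, hence `𝔮 = 𝔪`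
  have hm𝔮 : maximalIdeal (X.presheaf.stalk x) ≤ 𝔮 :=
    fun r hr => h𝔮.mem_of_pow_mem N (hN 𝔮 hle (Ideal.pow_mem_pow hr N))
  exact (IsLocalRing.le_maximalIdeal h𝔮.ne_top).antisymm hm𝔮

end Scheme

/-! ## §3 v2 APPEND (2026-08-27): TRANSFER of the approximate exit along a DENSE map with matching `𝔪`-adic filtrations —
## the completion `R → R̂` and Cohen coordinates `R → R̂ ≅ K⟦X⟧` (how the formal side of W4.6 rung (iii) consumes §2).
## PURE APPEND: §1–§2 byte-identical to v1 (p544366). -/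

section Transfer

variable {R : Type*} {S : Type*} [CommRing R] [CommRing S] [IsLocalRing R] [IsLocalRing S]

omit [IsLocalRing S] in
/-- `(I + L)^b ⊆ I^b + L` for ideals (`b = 0`: both sides are `⊤`). [folklore] -/
private theorem supPow_le_powSup_aux (I L : Ideal S) : ∀ b : ℕ, (I ⊔ L) ^ b ≤ I ^ b ⊔ L
  | 0 => by simp
  | b + 1 => by
    rw [pow_succ, pow_succ]
    calc (I ⊔ L) ^ b * (I ⊔ L) ≤ (I ^ b ⊔ L) * (I ⊔ L) := Ideal.mul_mono_left (supPow_le_powSup_aux I L b)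
      _ ≤ I ^ b * I ⊔ L := by
        rw [Ideal.sup_mul, Ideal.mul_sup, Ideal.mul_sup]
        exact sup_le (sup_le le_sup_left (Ideal.mul_le_left.trans le_sup_right))
          (sup_le (Ideal.mul_le_right.trans le_sup_right) (Ideal.mul_le_right.trans le_sup_right))

/-- **Transfer of the approximate exit along a dense map with matching `𝔪`-adic filtrations.** Let `ι : R → S` be a ring map of
local rings with `𝔪_R S = 𝔪_S`, `ι⁻¹(𝔪_S^n) = 𝔪_R^n` for all `n`, and dense image (`S = ι(R) + 𝔪_S^n` for all `n`) — e.g. the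
completion `R → R̂` of a Noetherian local ring, possibly followed by an isomorphism `R̂ ≅ K⟦X⟧` — and let `S` be Noetherian. If `J ⊆ R`
satisfies the approximate exit with exponent `b ≥ 1` and bound `N` (`J ⊆ 𝔟^b + 𝔪_R^{N+b} ⇒ 𝔪_R^N ⊆ 𝔟` for every ideal `𝔟 ⊆ R`), then so
does `J S`: `J S ⊆ 𝔞^b + 𝔪_S^{N+b} ⇒ 𝔪_S^N ⊆ 𝔞` for every ideal `𝔞 ⊆ S`. Proof: with `M = N + b`, `π : R → S/𝔪_S^M` is onto with
kernel `𝔪_R^M`, so `ι⁻¹(I S + 𝔪_S^M) = I` for `I ⊇ 𝔪_R^M`; for `𝔟 := ι⁻¹(𝔞 + 𝔪_S^M)` density gives `𝔞 + 𝔪_S^M = 𝔟 S + 𝔪_S^M`, hence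
`J ⊆ 𝔟^b + 𝔪_R^M`, `𝔪_R^N ⊆ 𝔟`, `𝔪_S^N ⊆ 𝔞 + 𝔪_S^{N+1}`, and Nakayama in `S`. [cite: StacksProject, Tag 05GG] [cite: StacksProject, Tag 00DV (4)] -/
theorem pow_le_of_map_le_sup_pow_of_dense [IsNoetherianRing S] (ι : R →+* S)
    (hmap : (maximalIdeal R).map ι = maximalIdeal S)
    (hcomap : ∀ (n : ℕ) (x : R), ι x ∈ maximalIdeal S ^ n → x ∈ maximalIdeal R ^ n)
    (hdense : ∀ (s : S) (n : ℕ), ∃ r : R, s - ι r ∈ maximalIdeal S ^ n)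
    {J : Ideal R} {b N : ℕ} (hb : 0 < b)
    (hexit : ∀ 𝔟 : Ideal R, J ≤ 𝔟 ^ b ⊔ maximalIdeal R ^ (N + b) → maximalIdeal R ^ N ≤ 𝔟)
    {𝔞 : Ideal S} (h : J.map ι ≤ 𝔞 ^ b ⊔ maximalIdeal S ^ (N + b)) : maximalIdeal S ^ N ≤ 𝔞 := by
  have hmapn : ∀ n, (maximalIdeal R ^ n).map ι = maximalIdeal S ^ n := fun n => by rw [Ideal.map_pow, hmap]
  -- the surjection `π : R → S ⧸ 𝔪_S^M`, `M = N + b`, and its kernel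
  have hqsurj : Function.Surjective (Ideal.Quotient.mk (maximalIdeal S ^ (N + b))) := Ideal.Quotient.mk_surjective
  have hπsurj : Function.Surjective ((Ideal.Quotient.mk (maximalIdeal S ^ (N + b))).comp ι) := by
    intro y
    obtain ⟨s, rfl⟩ := hqsurj y
    obtain ⟨r, hr⟩ := hdense s (N + b)
    refine ⟨r, ?_⟩
    rw [RingHom.comp_apply, eq_comm, Ideal.Quotient.mk_eq_mk_iff_sub_mem]
    exact hr
  have hkerπ : RingHom.ker ((Ideal.Quotient.mk (maximalIdeal S ^ (N + b))).comp ι) = maximalIdeal R ^ (N + b) := by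
    ext x
    rw [RingHom.mem_ker, RingHom.comp_apply, Ideal.Quotient.eq_zero_iff_mem]
    exact ⟨hcomap (N + b) x, fun hx => hmapn (N + b) ▸ Ideal.mem_map_of_mem ι hx⟩
  -- `ι⁻¹(I S + 𝔪_S^M) = I` for `I ⊇ 𝔪_R^M`
  have hkey : ∀ I : Ideal R, maximalIdeal R ^ (N + b) ≤ I → (I.map ι ⊔ maximalIdeal S ^ (N + b)).comap ι = I := by
    intro I hI
    have h1 : I.map ι ⊔ maximalIdeal S ^ (N + b) =
        ((I.map ι).map (Ideal.Quotient.mk (maximalIdeal S ^ (N + b)))).comap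
          (Ideal.Quotient.mk (maximalIdeal S ^ (N + b))) := by
      rw [Ideal.comap_map_of_surjective _ hqsurj, ← RingHom.ker_eq_comap_bot, Ideal.mk_ker]
    rw [h1, Ideal.comap_comap, Ideal.map_map, Ideal.comap_map_of_surjective _ hπsurj, ← RingHom.ker_eq_comap_bot, hkerπ]
    exact sup_eq_left.mpr hI
  -- `𝔟 := ι⁻¹(𝔞 + 𝔪_S^M)`; density: `𝔞 + 𝔪_S^M = 𝔟 S + 𝔪_S^M`
  set 𝔞₁ : Ideal S := 𝔞 ⊔ maximalIdeal S ^ (N + b) with h𝔞₁def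
  have h𝔞₁ : 𝔞₁ = (𝔞₁.comap ι).map ι ⊔ maximalIdeal S ^ (N + b) := by
    refine le_antisymm (fun s hs => ?_) (sup_le Ideal.map_comap_le le_sup_right)
    obtain ⟨r, hr⟩ := hdense s (N + b)
    have hιr : ι r ∈ 𝔞₁ := by
      have : ι r = s - (s - ι r) := by ring
      rw [this]
      exact Ideal.sub_mem _ hs (Ideal.mem_sup_right hr)
    have : s = ι r + (s - ι r) := by ring
    rw [this]
    exact Ideal.add_mem _ (Ideal.mem_sup_left (Ideal.mem_map_of_mem ι hιr)) (Ideal.mem_sup_right hr)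
  -- `J ⊆ 𝔟^b + 𝔪_R^M`
  have hJ : J ≤ (𝔞₁.comap ι) ^ b ⊔ maximalIdeal R ^ (N + b) := by
    rw [← hkey _ (le_sup_right : maximalIdeal R ^ (N + b) ≤ (𝔞₁.comap ι) ^ b ⊔ maximalIdeal R ^ (N + b)),
      ← Ideal.map_le_iff_le_comap]
    calc J.map ι ≤ 𝔞 ^ b ⊔ maximalIdeal S ^ (N + b) := h
      _ ≤ 𝔞₁ ^ b ⊔ maximalIdeal S ^ (N + b) := sup_le_sup_right (Ideal.pow_right_mono le_sup_left b) _
      _ = ((𝔞₁.comap ι).map ι ⊔ maximalIdeal S ^ (N + b)) ^ b ⊔ maximalIdeal S ^ (N + b) := by rw [← h𝔞₁]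
      _ ≤ ((𝔞₁.comap ι).map ι) ^ b ⊔ maximalIdeal S ^ (N + b) := sup_le (supPow_le_powSup_aux _ _ b) le_sup_right
      _ = ((𝔞₁.comap ι) ^ b ⊔ maximalIdeal R ^ (N + b)).map ι ⊔ maximalIdeal S ^ (N + b) := by
        rw [Ideal.map_sup, ← Ideal.map_pow, hmapn, sup_assoc, sup_idem]
  -- exit in `R`, back to `S`, Nakayama
  have hN𝔟 := hexit _ hJ
  have h2 : maximalIdeal S ^ N ≤ 𝔞 ⊔ maximalIdeal S ^ (N + 1) :=
    calc maximalIdeal S ^ N = (maximalIdeal R ^ N).map ι := (hmapn N).symm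
      _ ≤ (𝔞₁.comap ι).map ι := Ideal.map_mono hN𝔟
      _ ≤ 𝔞₁ := Ideal.map_comap_le
      _ ≤ 𝔞 ⊔ maximalIdeal S ^ (N + 1) := sup_le_sup_left (Ideal.pow_le_pow_right (by omega)) _
  exact pow_le_of_pow_le_of_le_sup_pow_succ (maximalIdeal_le_jacobson ⊥) (IsNoetherian.noetherian _) le_rfl h2

/-- **The approximate exit passes to Cohen coordinates `R → R̂ ≅ T`** (the `𝔪_R`-adic completion of a Noetherian local ring `R`
followed by any ring isomorphism `e` onto a local ring `T`, e.g. `T = K⟦X⟧`; `T` is then Noetherian): if `J ⊆ R` satisfies the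
approximate exit with exponent `b ≥ 1` and bound `N`, then `J·T ⊆ 𝔞^b + 𝔪_T^{N+b} ⇒ 𝔪_T^N ⊆ 𝔞` for every ideal `𝔞 ⊆ T`. The three
hypotheses of `pow_le_of_map_le_sup_pow_of_dense` for `e ∘ (R → R̂)`: `𝔪_R ↦ 𝔪` (`AdicCompletion.maximalIdeal_eq_map`,
`IsLocalRing.map_ringEquiv_maximalIdeal`), `𝔪^n` read faithfully (`AdicCompletion.algebraMap_mem_map_pow_maximalIdeal_iff`), density
(`AdicCompletion.exists_sub_algebraMap_mem_map_pow`). [cite: StacksProject, Tag 05GG] -/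
theorem pow_le_of_map_ringEquiv_adicCompletion_le_sup_pow [IsNoetherianRing R] {T : Type*} [CommRing T] [IsLocalRing T]
    (e : AdicCompletion (maximalIdeal R) R ≃+* T) {J : Ideal R} {b N : ℕ} (hb : 0 < b)
    (hexit : ∀ 𝔟 : Ideal R, J ≤ 𝔟 ^ b ⊔ maximalIdeal R ^ (N + b) → maximalIdeal R ^ N ≤ 𝔟)
    {𝔞 : Ideal T} (h : J.map ((e : _ →+* T).comp (algebraMap R (AdicCompletion (maximalIdeal R) R))) ≤
      𝔞 ^ b ⊔ maximalIdeal T ^ (N + b)) :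
    maximalIdeal T ^ N ≤ 𝔞 := by
  haveI : IsNoetherianRing (AdicCompletion (maximalIdeal R) R) := isNoetherianRing_adicCompletion_maximalIdeal R
  haveI : IsNoetherianRing T := isNoetherianRing_of_ringEquiv (AdicCompletion (maximalIdeal R) R) e
  have hmap₀ : (maximalIdeal R).map (algebraMap R (AdicCompletion (maximalIdeal R) R)) =
      maximalIdeal (AdicCompletion (maximalIdeal R) R) := AdicCompletion.maximalIdeal_eq_map.symm
  have hmap : (maximalIdeal R).map ((e : _ →+* T).comp (algebraMap R (AdicCompletion (maximalIdeal R) R))) =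
      maximalIdeal T := by
    rw [← Ideal.map_map, hmap₀]
    exact IsLocalRing.map_ringEquiv_maximalIdeal e
  have hmapT : ∀ n, (maximalIdeal (AdicCompletion (maximalIdeal R) R) ^ n).map e = maximalIdeal T ^ n :=
    fun n => by rw [Ideal.map_pow, IsLocalRing.map_ringEquiv_maximalIdeal e]
  have hmapT' : ∀ n, (maximalIdeal T ^ n).map e.symm = maximalIdeal (AdicCompletion (maximalIdeal R) R) ^ n :=
    fun n => by rw [Ideal.map_pow, IsLocalRing.map_ringEquiv_maximalIdeal e.symm]
  refine pow_le_of_map_le_sup_pow_of_dense _ hmap (fun n x hx => ?_) (fun t n => ?_) hb hexit h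
  · -- `e (x̂) ∈ 𝔪_T^n ⇒ x̂ ∈ 𝔪_R̂^n ⇒ x ∈ 𝔪_R^n`
    rw [RingHom.comp_apply, RingHom.coe_coe] at hx
    have h1 : algebraMap R (AdicCompletion (maximalIdeal R) R) x ∈
        maximalIdeal (AdicCompletion (maximalIdeal R) R) ^ n := by
      have h2 := Ideal.mem_map_of_mem e.symm hx
      rwa [hmapT', e.symm_apply_apply] at h2
    rw [← hmap₀, ← Ideal.map_pow] at h1
    exact (AdicCompletion.algebraMap_mem_map_pow_maximalIdeal_iff n x).mp h1
  · -- density: approximate `e⁻¹ t`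
    obtain ⟨r, hr⟩ := AdicCompletion.exists_sub_algebraMap_mem_map_pow n (e.symm t)
    refine ⟨r, ?_⟩
    rw [Ideal.map_pow, hmap₀] at hr
    have h2 := Ideal.mem_map_of_mem e hr
    rw [hmapT, map_sub, e.apply_symm_apply] at h2
    rwa [RingHom.comp_apply, RingHom.coe_coe]

/-- **The approximate exit passes to the completion `R̂`** of a Noetherian local ring (`e = id` in
`pow_le_of_map_ringEquiv_adicCompletion_le_sup_pow`). [cite: StacksProject, Tag 05GG] -/
theorem pow_le_of_map_adicCompletion_le_sup_pow [IsNoetherianRing R] {J : Ideal R} {b N : ℕ} (hb : 0 < b)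
    (hexit : ∀ 𝔟 : Ideal R, J ≤ 𝔟 ^ b ⊔ maximalIdeal R ^ (N + b) → maximalIdeal R ^ N ≤ 𝔟)
    {𝔞 : Ideal (AdicCompletion (maximalIdeal R) R)}
    (h : J.map (algebraMap R (AdicCompletion (maximalIdeal R) R)) ≤
      𝔞 ^ b ⊔ maximalIdeal (AdicCompletion (maximalIdeal R) R) ^ (N + b)) :
    maximalIdeal (AdicCompletion (maximalIdeal R) R) ^ N ≤ 𝔞 := by
  refine pow_le_of_map_ringEquiv_adicCompletion_le_sup_pow (RingEquiv.refl _) hb hexit ?_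
  rwa [RingEquiv.coe_ringHom_refl, RingHom.id_comp]

end Transfer

end Literature.AlgebraicGeometry.Resolution

end
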